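import Mathlib

/-!
# Leading minors of a coordinatewise-disjoint rank-one unipotent (door L, pencil lemma)

Solo-blind seat, `MatrixMultiplication` (door L = Lie-group TPP / Lie exponent,
Blasiak–Cohn–Grochow–Pratt–Umans, arXiv:2204.03826 §4).  This file records, in kernel form, the
mechanism behind the unipotent-pencil obstructions of the seat's note (LieExponent.md, Addendum 3.6,
Lemmas 3.6–3.9 / Theorem 3.8): for `u v : Fin n → R` the leading principal `j × j` minor of the
rank-one perturbation `1 + u vᵀ` is `1 + Σ_{i<j} uᵢ vᵢ` (matrix determinant lemma applied to the
leading block), hence if the supports of `u` and `v` are coordinatewise disjoint (`uᵢ vᵢ = 0` for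
all `i`) then EVERY leading principal minor of `1 + u vᵀ` equals `1` — such an element lies in the
open Bruhat cell with trivial torus part (`U⁻ U⁺`) and is a TPP violation for every weight
character in the `(T_a U⁺, T_b U⁻, H₃)` format.  Elementary observation of this seat; no external
source beyond Mathlib's `Matrix.det_one_add_replicateCol_mul_replicateRow`.
-/

set_option linter.dupNamespace false

namespace Summit.MatrixMultiplication.MatrixMultiplication.Theorems

open Matrix

/-- The leading `j × j` block of `1 + u vᵀ` is `1 + u' v'ᵀ` for the truncated vectors
`u' = u ∘ castLE`, `v' = v ∘ castLE`. -/
theorem soloLie_submatrix_one_add_vecMulVec {R : Type*} [CommRing R] {n j : ℕ} (hj : j ≤ n)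
    (u v : Fin n → R) :
    (1 + vecMulVec u v).submatrix (Fin.castLE hj) (Fin.castLE hj)
      = 1 + vecMulVec (u ∘ Fin.castLE hj) (v ∘ Fin.castLE hj) := by
  ext a b
  simp only [submatrix_apply, Matrix.add_apply, vecMulVec_apply, Function.comp_apply, one_apply,
    (Fin.castLE_injective hj).eq_iff]

/-- Leading principal minors of a rank-one perturbation of the identity:
`det ((1 + u vᵀ)_{[j]}) = 1 + Σ_{i : Fin j} uᵢ vᵢ` (indices transported along `Fin.castLE`). -/
theorem soloLie_leadingMinor_one_add_vecMulVec {R : Type*} [CommRing R] {n j : ℕ} (hj : j ≤ n)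
    (u v : Fin n → R) :
    ((1 + vecMulVec u v).submatrix (Fin.castLE hj) (Fin.castLE hj)).det
      = 1 + ∑ i : Fin j, u (Fin.castLE hj i) * v (Fin.castLE hj i) := by
  rw [soloLie_submatrix_one_add_vecMulVec hj, vecMulVec_eq (Fin 1),
    det_one_add_replicateCol_mul_replicateRow]
  simp only [dotProduct, Function.comp_apply]
  congr 1
  exact Finset.sum_congr rfl fun i _ => mul_comm _ _

/-- PENCIL LEMMA (kernel form).  If `u` and `v` have coordinatewise-disjoint supports
(`uᵢ vᵢ = 0` for all `i`), then every leading principal minor of the unipotent `1 + u vᵀ`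
equals `1` (in particular `det (1 + u vᵀ) = 1`, the case `j = n`). -/
theorem soloLie_leadingMinors_eq_one_of_disjoint {R : Type*} [CommRing R] {n : ℕ}
    (u v : Fin n → R) (huv : ∀ i, u i * v i = 0) {j : ℕ} (hj : j ≤ n) :
    ((1 + vecMulVec u v).submatrix (Fin.castLE hj) (Fin.castLE hj)).det = 1 := by
  rw [soloLie_leadingMinor_one_add_vecMulVec hj]
  simp [huv]

/-- The same element is nontrivial as soon as some `uᵢ ≠ 0` and some `vₖ ≠ 0`:
`1 + u vᵀ ≠ 1`.  Together with the previous theorem: a coordinatewise-disjoint pair with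
`u, v ≠ 0` gives an element `≠ 1` all of whose leading principal minors are `1`. -/
theorem soloLie_one_add_vecMulVec_ne_one {R : Type*} [CommRing R] [NoZeroDivisors R] {n : ℕ}
    (u v : Fin n → R) {i k : Fin n} (hi : u i ≠ 0) (hk : v k ≠ 0) :
    (1 : Matrix (Fin n) (Fin n) R) + vecMulVec u v ≠ 1 := by
  intro h
  have hik := congrFun (congrFun h i) k
  simp [Matrix.add_apply, vecMulVec_apply, hi, hk] at hik

end Summit.MatrixMultiplication.MatrixMultiplication.Theorems
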